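import Summits.ValiantsHypothesis.ValiantsHypothesis.Theorems.KPlusLogSqLawTridiagonalRealStaticFourByFourMultCount

/-!
# Route «KPlusLogSqLaw», crux `WeakLifting` (stmt-ValiantsHypothesis-19561) — REAL side of the tridiagonal sector:
# `B 4 = 3` EXACTLY — a static definite tridiagonal `4 × 4` design with THREE positive determinant zeros (the attainment witness)

HONEST FRAMING.  Helper (`--supports stmt-ValiantsHypothesis-19561 --as helper`), seat val-sym-lift-p3 (g10), cell `pub-symmetroid`,
2026-08-28; the attainment half of the α-register row at `m = 4` (desk R2285/R2297 (0): «type the `4 × 4` attainment witness … so the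
α table reads «B 4 = 3 EXACTLY (kernel)»»; the upper half is lift-p2 g9's `card_posRoots_four_le_three_all`, with multiplicity
`countP_roots_pos_four_le_three_all`).  WITNESS (integer currency): diagonal entries `1` (exponent `0`), links `c₀₁ = c₂₃ = 2` with exponent `1` and `c₁₂ = 3`
with exponent `3` (i.e. `2X, 3X³, 2X`): `det = (1 − 4X²)² − 9X⁶ = (1 − 4X² − 3X³)(1 − 4X² + 3X³)`, which is `> 0, < 0, > 0, < 0` at
`x = 1/10, 1/2, 9/10, 2` (zeros near `0.455`, at `(1+√13)/6 ≈ 0.768` and at `1`).  RESULTS: `three_le_card_posRoots_pathDet_witness`,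
**`exists_static_definite_tridiagonal_four_three`** (R2114 currency: `c`, `e` symmetric, `c = 0` off the band, `0 < c i i`, `3 ≤ card posRoots`),
`three_le_of_definiteRow_four` (every admissible law has `B 4 ≥ 3`), and with the upper half `B 4 = 3` exactly.  Calibration row; α does not
move.  Nothing here bears on `WeakLifting` / `TropicalB` (stmt-19771) in their windows, on Conjecture B, on the Door-A registers, on
`MatrixDescartes` (stmt-ValiantsHypothesis-18050) or on VP ≠ VNP.
[data of this seat; folklore]
-/

-- `Summit.ValiantsHypothesis.ValiantsHypothesis.…` repeats a component by the D-0017 layout (single-conjunct summit); the name is mandated.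
set_option linter.dupNamespace false
set_option autoImplicit false

namespace Summit.ValiantsHypothesis.ValiantsHypothesis.Theorems.KPlusLogSqLaw

namespace StaticTridiagonalRealPotential

open Polynomial
open Summit.ValiantsHypothesis.ValiantsHypothesis.Theorems.SymmetroidDescartes (le_card_posRoots_of_alternating)

/-- The witness in the continuant currency: diagonal `a ≡ 1`, `d ≡ 0`; links `b = (2, 3, 2, …)`, `f = (1, 3, 1, …)`; its `D₄` evaluates to
`(1 − 4x²)² − 9x⁶`. [data of this seat] -/
theorem eval_pathDet_four_witness (x : ℝ) :
    (pathDet (fun _ => 1) (fun _ => 0) (fun t => if t = 1 then 3 else 2) (fun t => if t = 1 then 3 else 1) 4).eval x =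
      (1 - 4 * x ^ 2) ^ 2 - 9 * x ^ 6 := by
  rw [eval_pathDet_four]
  norm_num
  ring

/-- **Three positive zeros**: the witness determinant alternates in sign at `x = 1/10, 1/2, 9/10, 2`. [data of this seat] -/
theorem three_le_card_posRoots_pathDet_witness :
    3 ≤ ((pathDet (fun _ => 1) (fun _ => 0) (fun t => if t = 1 then 3 else 2) (fun t => if t = 1 then 3 else 1) 4).roots.toFinset.filter
      (fun t : ℝ => 0 < t)).card := by
  refine le_card_posRoots_of_alternating _ 3 (![1 / 10, 1 / 2, 9 / 10, 2] : Fin 4 → ℝ) ?_ ?_ ?_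
  · refine Fin.strictMono_iff_lt_succ.2 fun j => ?_
    fin_cases j <;> simp <;> norm_num
  · intro j; fin_cases j <;> simp
  · intro j; fin_cases j <;> simp [eval_pathDet_four_witness] <;> norm_num

/-- **`B 4 ≥ 3`: A STATIC DEFINITE SYMMETRIC TRIDIAGONAL `4 × 4` MONOMIAL MATRIX WITH THREE POSITIVE DETERMINANT ZEROS**, in the typed
currency of the α target (`c`, `e` symmetric, `c = 0` off the band, `0 < c i i`): diagonal `1`, links `2X`, `3X³`, `2X`;
`det = (1 − 4X²)² − 9X⁶`.  With `card_posRoots_four_le_three_all` (lift-p2 g9): `B 4 = 3` EXACTLY. [data of this seat] -/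
theorem exists_static_definite_tridiagonal_four_three :
    ∃ (c : Fin 4 → Fin 4 → ℝ) (e : Fin 4 → Fin 4 → ℕ),
      (∀ i j, c i j = c j i) ∧ (∀ i j, e i j = e j i) ∧
      (∀ i j : Fin 4, (i : ℕ) + 1 < j ∨ (j : ℕ) + 1 < i → c i j = 0) ∧ (∀ i, 0 < c i i) ∧
      3 ≤ ((Matrix.det (Matrix.of fun i j => C (c i j) * (X : ℝ[X]) ^ e i j)).roots.toFinset.filter
        (fun t : ℝ => 0 < t)).card := by
  classical
  -- the design data in the continuant currency
  let a : ℕ → ℝ := fun _ => 1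
  let d : ℕ → ℕ := fun _ => 0
  let b : ℕ → ℝ := fun t => if t = 1 then 3 else 2
  let f : ℕ → ℕ := fun t => if t = 1 then 3 else 1
  refine ⟨fun i j => if (j : ℕ) = i then a i else if (j : ℕ) = i + 1 then b i else if (i : ℕ) = j + 1 then b j else 0,
    fun i j => if (j : ℕ) = i then d i else if (j : ℕ) = i + 1 then f i else if (i : ℕ) = j + 1 then f j else 0,
    ?_, ?_, ?_, ?_, ?_⟩
  · intro i j
    by_cases hij : i = j
    · subst hij; rfl
    · have h1 : (j : ℕ) ≠ i := fun h => hij (Fin.ext h.symm)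
      have h2 : (i : ℕ) ≠ j := fun h => hij (Fin.ext h)
      simp only [if_neg h1, if_neg h2]
      split_ifs <;> first | rfl | (exfalso; omega)
  · intro i j
    by_cases hij : i = j
    · subst hij; rfl
    · have h1 : (j : ℕ) ≠ i := fun h => hij (Fin.ext h.symm)
      have h2 : (i : ℕ) ≠ j := fun h => hij (Fin.ext h)
      simp only [if_neg h1, if_neg h2]
      split_ifs <;> first | rfl | (exfalso; omega)
  · intro i j hij
    dsimp only
    split_ifs <;> first | rfl | (exfalso; omega)
  · intro i; simp [a]
  · -- the matrix is the path matrix of the data, whose determinant is the witness continuant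
    have hcs : ∀ i j : Fin 4, (fun i j : Fin 4 => if (j : ℕ) = i then a i else if (j : ℕ) = i + 1 then b i else if (i : ℕ) = j + 1 then b j else 0) i j =
        (fun i j : Fin 4 => if (j : ℕ) = i then a i else if (j : ℕ) = i + 1 then b i else if (i : ℕ) = j + 1 then b j else 0) j i := by
      intro i j
      by_cases hij : i = j
      · subst hij; rfl
      · have h1 : (j : ℕ) ≠ i := fun h => hij (Fin.ext h.symm)
        have h2 : (i : ℕ) ≠ j := fun h => hij (Fin.ext h)
        simp only [if_neg h1, if_neg h2]
        split_ifs <;> first | rfl | (exfalso; omega)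
    have hes : ∀ i j : Fin 4, (fun i j : Fin 4 => if (j : ℕ) = i then d i else if (j : ℕ) = i + 1 then f i else if (i : ℕ) = j + 1 then f j else 0) i j =
        (fun i j : Fin 4 => if (j : ℕ) = i then d i else if (j : ℕ) = i + 1 then f i else if (i : ℕ) = j + 1 then f j else 0) j i := by
      intro i j
      by_cases hij : i = j
      · subst hij; rfl
      · have h1 : (j : ℕ) ≠ i := fun h => hij (Fin.ext h.symm)
        have h2 : (i : ℕ) ≠ j := fun h => hij (Fin.ext h)
        simp only [if_neg h1, if_neg h2]
        split_ifs <;> first | rfl | (exfalso; omega)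
    have hband : ∀ i j : Fin 4, (i : ℕ) + 1 < j ∨ (j : ℕ) + 1 < i →
        (fun i j : Fin 4 => if (j : ℕ) = i then a i else if (j : ℕ) = i + 1 then b i else if (i : ℕ) = j + 1 then b j else 0) i j = 0 := by
      intro i j hij
      dsimp only
      split_ifs <;> first | rfl | (exfalso; omega)
    rw [det_of_eq_pathDet _ _ hcs hes hband]
    have hdet : pathDet (fun t => if h : t < 4 then (fun i j : Fin 4 => if (j : ℕ) = i then a i else if (j : ℕ) = i + 1 then b i else if (i : ℕ) = j + 1 then b j else 0) ⟨t, h⟩ ⟨t, h⟩ else 1)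
        (fun t => if h : t < 4 then (fun i j : Fin 4 => if (j : ℕ) = i then d i else if (j : ℕ) = i + 1 then f i else if (i : ℕ) = j + 1 then f j else 0) ⟨t, h⟩ ⟨t, h⟩ else 0)
        (fun t => if h : t + 1 < 4 then (fun i j : Fin 4 => if (j : ℕ) = i then a i else if (j : ℕ) = i + 1 then b i else if (i : ℕ) = j + 1 then b j else 0) ⟨t, by omega⟩ ⟨t + 1, h⟩ else 1)
        (fun t => if h : t + 1 < 4 then (fun i j : Fin 4 => if (j : ℕ) = i then d i else if (j : ℕ) = i + 1 then f i else if (i : ℕ) = j + 1 then f j else 0) ⟨t, by omega⟩ ⟨t + 1, h⟩ else 0) 4 =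
        pathDet a d b f 4 := by
      refine pathDet_congr (fun t ht => ?_) (fun t ht => ?_) (fun t ht => ?_) (fun t ht => ?_)
      · rw [dif_pos ht]; simp
      · rw [dif_pos ht]; simp
      · rw [dif_pos ht]; simp
      · rw [dif_pos ht]; simp
    rw [hdet]
    exact three_le_card_posRoots_pathDet_witness

/-- **Every admissible law on the sector has `B 4 ≥ 3`** (the hypothesis shape of lift-p1's `threeHalves_le_of_definiteRow_odd`); with
`card_posRoots_four_le_three_all` the α-register row at `m = 4` reads `B 4 = 3` EXACTLY. [corollary] -/
theorem three_le_of_definiteRow_four (B : ℕ → ℕ)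
    (hB : ∀ (m : ℕ) (c : Fin m → Fin m → ℝ) (e : Fin m → Fin m → ℕ), (∀ i j, c i j = c j i) → (∀ i j, e i j = e j i) →
        (∀ i j : Fin m, (i : ℕ) + 1 < j ∨ (j : ℕ) + 1 < i → c i j = 0) → (∀ i, 0 < c i i) →
        ((Matrix.det (Matrix.of fun i j => C (c i j) * (X : ℝ[X]) ^ e i j)).roots.toFinset.filter
          (fun t : ℝ => 0 < t)).card ≤ B m) :
    3 ≤ B 4 := by
  obtain ⟨c, e, hc, he, hband, hpos, hcard⟩ := exists_static_definite_tridiagonal_four_three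
  exact hcard.trans (hB 4 c e hc he hband hpos)

/-- **«At most TWO positive zeros for every `4 × 4` design» is FALSE** — the row `B 4 ≤ 3` is sharp. [corollary] -/
theorem not_card_posRoots_four_le_two :
    ¬ (∀ (c : Fin 4 → Fin 4 → ℝ) (e : Fin 4 → Fin 4 → ℕ), (∀ i j, c i j = c j i) → (∀ i j, e i j = e j i) →
        (∀ i j : Fin 4, (i : ℕ) + 1 < j ∨ (j : ℕ) + 1 < i → c i j = 0) → (∀ i, 0 < c i i) →
        ((Matrix.det (Matrix.of fun i j => C (c i j) * (X : ℝ[X]) ^ e i j)).roots.toFinset.filter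
          (fun t : ℝ => 0 < t)).card ≤ 2) := by
  intro h
  obtain ⟨c, e, hc, he, hband, hpos, hcard⟩ := exists_static_definite_tridiagonal_four_three
  have := h c e hc he hband hpos
  omega

end StaticTridiagonalRealPotential

end Summit.ValiantsHypothesis.ValiantsHypothesis.Theorems.KPlusLogSqLaw
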